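import Summits.QuantumFields.YangMills.Theorems.UnitScaleTiltAvgCurvGradRect
import Summits.QuantumFields.YangMills.Theorems.UnitScaleTiltAvgActionDefectIdentity
import HarnessLib

/-!
# Route `UnitScaleTilt`, crux K1 child «MinimiserStabilityRegPr» (stmt-QuantumFields-19200), stub `stub_avgCurvGrad` (G-K1a-3a′) — helper B:
# THE ONE-STEP COVARIANT DIFFERENCE OF A COARSE PLAQUETTE OF THE (0.4)-AVERAGED FIELD IS `≤ L³·b + 4L⁴·a² + 14t·L²a + 870t²`

Cell `ym3-torus` ∕ fleet seat `ym-ust-19200-p1` (HUMAN RULING D-0037, YM ladder rung R3).  The located gap G-K1a-3a′ (`AvgCurvGradAt`) at the level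
of ONE (0.4) block-averaging step on an arbitrary torus (`SU(N)` read in `M_N(ℂ)`, printed inner operation `exp[mean log]`): if every fine
plaquette is within `a` of `1` and every one-step covariant difference of the fine plaquette field (plane `μ < κ`, direction `ν`) is `≤ b`, then
for every coarse site `y`
`‖Ū(y,ν)⁻¹·Ū(∂p′(y))·Ū(y,ν) − Ū(∂p′(y + e_ν))‖ ≤ L³·b + 4L⁴·a² + 14t·L²a + 870t²`, `t = (((d+2)L)²/4)·a ≤ 1/10`, `t < δ_N`.

THE ARGUMENT.  By the sibling identity `AvgActionDefect.norm_plaqHol_avgFun_sub_mean_conj_rect_le` (p438132) each coarse plaquette is within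
`435t²` of the mean over `(r, σ)` of the staircase-transported `L × L` square holonomies `U(Γ^σ_{y,r})·U(∂R_{L,L}(blockSite y r))·U(Γ^σ_{y,r})⁻¹`;
conjugating by the coarse bond variable `Ū(y,ν) = corr·U(c)` commutes with the mean, the correction factor costs `2·6t·L²a` (§2), and for each
`(r, σ)` the conjugate rule `AvgCurvGrad.covDiff_conj_le` reduces the transported covariant difference to the `L`-step covariant difference of the
square (`covDiff_rect_steps_le`: `≤ L³b + 4L⁴a²`) plus the STAIRCASE LADDER loop `Γ̄′ (−ν)^L Γ (+ν)^L` (§1: a closed word of length `≤ (d+2)L`,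
within `t` of `1` by `LatticeWordStokes.dist1_holAt_le`), which costs `2t·L²a`.

* §1 the staircase ladder as a closed word; its length and its distance to `1`.
* §2 **`norm_covDiff_conj_rect_le`**: the per-`(r, σ)` bound `L³b + 4L⁴a² + 14t·L²a`.
* §3 means: conjugation commutes with the mean; **`norm_covDiff_plaqHol_avgFun_le`**: the bound of the title.

References: T. Bałaban, CMP 109 (1987) 249–301 [Balaban1987RG1] ((0.4) p.253); CMP 98 (1985) 17–51 [Balaban1985Averaging] ((9) p.19, (19)–(20)
p.21, Prop. 3 (122)–(123) p.36); CMP 99 (1985) 75–102 [Balaban1985RegularSpaces] ((1.1) p.76).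
-/

noncomputable section

open scoped BigOperators Matrix.Norms.L2Operator

namespace Summit.QuantumFields.YangMills.Theorems.AvgCurvGrad

open Literature.MathematicalPhysics.QuantumFieldTheory.Balaban1983to89
open T4Continuum BlockAveraging AveragingRT B10Eq47AxialChi ExpMeanLog LatticeWordStokes BlockAveragingPlaquetteBound
open Summit.QuantumFields.YangMills.Theorems.AvgActionDefect (norm_mean_le holAt_walk_replicate walkEnd_replicate blockSite_shift
  norm_plaqHol_avgFun_sub_mean_conj_rect_le)
open Summit.QuantumFields.BalabanUV.T4Continuum.Spine.NE7 (walkEnd_emb_stairWord walkEnd_blockSite_replicate)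

/-! ## §1 The staircase ladder is a closed word of length `≤ (d+2)L` -/

section Ladder

variable {P : Params} {j : ℕ} {G : Type*} [GaugeGroup G]

/-- **THE STAIRCASE LADDER AS A CLOSED WORD.**  For a coarse site `y`, an offset `r`, an ordering `σ` and a direction `ν`, with
`Γ = Γ^σ_{y,r}` (from `emb y` to `x_r = blockSite y r`), `Γ′ = Γ^σ_{y+e_ν,r}`, `U(c)` the straight transporter from `emb y` to `emb (y+e_ν)` and
`N` the straight transporter from `x_r` to `x_r + Le_ν = blockSite (y+e_ν) r`: `U(Γ′)⁻¹·U(c)⁻¹·U(Γ)·N` is the holonomy of the closed word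
`Γ̄ (−ν)^L Γ (+ν)^L` read from `blockSite (y+e_ν) r` (standing range). [cite: Balaban1985Averaging, (9) p.19] -/
theorem staircaseLadder_eq_holAt (hj : j + 1 ≤ P.m + P.K) (U : GaugeField P j G) (y : Site P (j + 1)) (ν : Fin P.d)
    (r : Fin P.d → Fin P.L) (σ : Equiv.Perm (Fin P.d)) :
    (holAt U (walk (emb (y.shift ν)) (stairWord σ (off r))))⁻¹ * (axialAvg U ⟨y, ν⟩)⁻¹ *
        holAt U (walk (emb y) (stairWord σ (off r))) * rowProd U (Site.blockSite y r) ν P.L =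
      holAt U (walk (Site.blockSite (y.shift ν) r)
        (wordRev (stairWord σ (off r)) ++ (List.replicate P.L (ν, false) ++ (stairWord σ (off r) ++ List.replicate P.L (ν, true))))) := by
  have hrep : List.replicate P.L (ν, false) = wordRev (List.replicate P.L (ν, true)) := (wordRev_replicate P.L (ν, true)).symm
  have hx' : emb (y.shift ν) = walkEnd (emb y) (List.replicate P.L (ν, true)) := by
    rw [walkEnd_replicate, emb_shift hj]
  conv_rhs => rw [← walkEnd_emb_stairWord (y.shift ν) σ r, walk_append, holAt_append, holAt_walk_wordRev, walkEnd_walkEnd_wordRev,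
    hrep, hx', walk_append, holAt_append, holAt_walk_wordRev, walkEnd_walkEnd_wordRev, walk_append, holAt_append,
    walkEnd_emb_stairWord, holAt_walk_replicate]
  rw [axialAvg_eq_holAt_walk, hx']
  simp only [holAt_walk_replicate, mul_assoc]

omit [GaugeGroup G] in
/-- The staircase ladder word is closed. [folklore] -/
theorem netDisp_staircaseLadder (ν : Fin P.d) (r : Fin P.d → Fin P.L) (σ : Equiv.Perm (Fin P.d)) (μ : Fin P.d) :
    netDisp (wordRev (stairWord σ (off r)) ++ (List.replicate P.L (ν, false) ++ (stairWord σ (off r) ++ List.replicate P.L (ν, true)))) μ = 0 := by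
  rw [T4ReflectionCone.netDisp_append, T4ReflectionCone.netDisp_append, T4ReflectionCone.netDisp_append, netDisp_wordRev,
    T4ReflectionCone.netDisp_replicate, T4ReflectionCone.netDisp_replicate]
  simp only [Bool.false_eq_true, if_false, if_true]
  split_ifs <;> ring

omit [GaugeGroup G] in
/-- The staircase ladder word has length `≤ (d+2)L` (two staircases of length `≤ d(L−1)/2` and two straight runs of length `L`).
[cite: Balaban1987RG1, (0.3) p.252] -/
theorem length_staircaseLadder_le (ν : Fin P.d) (r : Fin P.d → Fin P.L) (σ : Equiv.Perm (Fin P.d)) :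
    (wordRev (stairWord σ (off r)) ++ (List.replicate P.L (ν, false) ++ (stairWord σ (off r) ++ List.replicate P.L (ν, true)))).length ≤
      (P.d + 2) * P.L := by
  have hN : ∀ κ, (off r κ).natAbs ≤ (P.L - 1) / 2 := fun κ => by have h := off_bounds r κ; omega
  have hS := length_stairWord_le σ (off r) _ hN
  have hrev : (wordRev (stairWord σ (off r))).length = (stairWord σ (off r)).length := by simp [wordRev]
  simp only [List.length_append, List.length_replicate, hrev]
  have hhalf : 2 * ((P.L - 1) / 2) ≤ P.L := by omega
  nlinarith

/-- **THE STAIRCASE LADDER IS WITHIN `t = (((d+2)L)²/4)·a` OF `1`** under `PlaqSmall a U` (`a ≥ 0`; crude Stokes for the closed word of §1).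
[cite: Balaban1985Averaging, (9) p.19 and (19)-(20) p.21] -/
theorem dist1_staircaseLadder_le (hj : j + 1 ≤ P.m + P.K) {a : ℝ} (ha : 0 ≤ a) {U : GaugeField P j G} (hU : PlaqSmall a U)
    (y : Site P (j + 1)) (ν : Fin P.d) (r : Fin P.d → Fin P.L) (σ : Equiv.Perm (Fin P.d)) :
    dist1 ((holAt U (walk (emb (y.shift ν)) (stairWord σ (off r))))⁻¹ * (axialAvg U ⟨y, ν⟩)⁻¹ *
        holAt U (walk (emb y) (stairWord σ (off r))) * rowProd U (Site.blockSite y r) ν P.L) ≤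
      ((((P.d + 2) * P.L : ℕ) : ℝ) ^ 2 / 4) * a := by
  rw [staircaseLadder_eq_holAt hj]
  refine (dist1_holAt_le U ha hU _ (netDisp_staircaseLadder ν r σ) _).trans (mul_le_mul_of_nonneg_right ?_ ha)
  have hlen : ((wordRev (stairWord σ (off r)) ++ (List.replicate P.L (ν, false) ++
      (stairWord σ (off r) ++ List.replicate P.L (ν, true)))).length : ℝ) ≤ (((P.d + 2) * P.L : ℕ) : ℝ) := by
    exact_mod_cast length_staircaseLadder_le ν r σ
  have h0 : (0 : ℝ) ≤ ((wordRev (stairWord σ (off r)) ++ (List.replicate P.L (ν, false) ++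
      (stairWord σ (off r) ++ List.replicate P.L (ν, true)))).length : ℝ) := Nat.cast_nonneg _
  nlinarith

end Ladder


/-! ## §2 The per-`(r, σ)` bound -/

section PerQ

variable {n : Type*} [Fintype n] [DecidableEq n] [Nonempty n] {P : Params} {j : ℕ}

omit [Nonempty n] in
/-- `↑(g * h) = ↑g * ↑h` for special unitary matrices (explicit arguments, for targeted rewriting). [folklore] -/
private theorem coe_mul_su (g h : Matrix.specialUnitaryGroup n ℂ) :
    ((g * h : Matrix.specialUnitaryGroup n ℂ) : Matrix n n ℂ) = (g : Matrix n n ℂ) * (h : Matrix n n ℂ) := rfl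

/-- **THE TRANSPORTED SQUARE, ONE COARSE STEP**: conjugating the staircase-transported `L × L` square holonomy at `y` by the coarse bond variable
`Ū(y,ν) = corr·U(c)` of the (0.4) average and comparing with the same object at `y + e_ν`:
`≤ L³·b + 4L⁴·a² + 14t·(L²a)`, `t = (((d+2)L)²/4)·a < δ_N` — the correction factor costs `2·6t·L²a` (`dist1_corr_le`), the conjugate rule
(`covDiff_conj_le`) leaves the `L`-step covariant difference of the square (`covDiff_rect_steps_le`: `L³b + 4L⁴a²`) and the staircase ladder
(§1: within `t` of `1`) acting on the square (`≤ L²a`): `2t·L²a`. [cite: Balaban1985Averaging, Prop. 3 (122)-(123) p.36] -/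
theorem norm_covDiff_conj_rect_le (hj : j + 1 ≤ P.m + P.K) {a b : ℝ} (ha : 0 ≤ a)
    {U : GaugeField P j (Matrix.specialUnitaryGroup n ℂ)} (hU : PlaqSmall a U)
    (hδ : ((((P.d + 2) * P.L : ℕ) : ℝ) ^ 2 / 4) * a < deltaSU n) {μ κ : Fin P.d} (hμκ : μ < κ) (ν : Fin P.d)
    (hb : ∀ z : Site P j, ‖(((U ⟨z, ν⟩)⁻¹ * GaugeField.plaqHol U ⟨z, μ, κ, hμκ⟩ * U ⟨z, ν⟩ : Matrix.specialUnitaryGroup n ℂ) :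
        Matrix n n ℂ) - ((GaugeField.plaqHol U ⟨z.shift ν, μ, κ, hμκ⟩ : Matrix.specialUnitaryGroup n ℂ) : Matrix n n ℂ)‖ ≤ b)
    (y : Site P (j + 1)) (r : Fin P.d → Fin P.L) (σ : Equiv.Perm (Fin P.d)) :
    ‖(((avgFun (expMeanLogSU (n := n)) U ⟨y, ν⟩)⁻¹ *
            (holAt U (walk (emb y) (stairWord σ (off r))) * rect U (Site.blockSite y r) μ κ P.L P.L *
              (holAt U (walk (emb y) (stairWord σ (off r))))⁻¹) *
            avgFun (expMeanLogSU (n := n)) U ⟨y, ν⟩ : Matrix.specialUnitaryGroup n ℂ) : Matrix n n ℂ) -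
        ((holAt U (walk (emb (y.shift ν)) (stairWord σ (off r))) * rect U (Site.blockSite (y.shift ν) r) μ κ P.L P.L *
            (holAt U (walk (emb (y.shift ν)) (stairWord σ (off r))))⁻¹ : Matrix.specialUnitaryGroup n ℂ) : Matrix n n ℂ)‖ ≤
      (P.L : ℝ) ^ 3 * b + 4 * (P.L : ℝ) ^ 4 * a ^ 2 + 14 * (((((P.d + 2) * P.L : ℕ) : ℝ) ^ 2 / 4) * a) * ((P.L : ℝ) ^ 2 * a) := by
  set t : ℝ := ((((P.d + 2) * P.L : ℕ) : ℝ) ^ 2 / 4) * a with ht_def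
  set h₀ := holAt U (walk (emb y) (stairWord σ (off r))) with hh₀
  set h₁ := holAt U (walk (emb (y.shift ν)) (stairWord σ (off r))) with hh₁
  set R₀ := rect U (Site.blockSite y r) μ κ P.L P.L with hR₀
  set R₁ := rect U (Site.blockSite (y.shift ν) r) μ κ P.L P.L with hR₁
  set C := corr (expMeanLogSU (n := n)) U ⟨y, ν⟩ with hC
  set A := axialAvg U ⟨y, ν⟩ with hA
  set N := rowProd U (Site.blockSite y r) ν P.L with hN
  have hu : avgFun (expMeanLogSU (n := n)) U ⟨y, ν⟩ = C * A := rfl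
  have ht0 : 0 ≤ t := by positivity
  have hL : (0 : ℝ) ≤ P.L := Nat.cast_nonneg _
  have hL2a : 0 ≤ (P.L : ℝ) ^ 2 * a := by positivity
  -- sizes
  have hR₀1 : dist1 R₀ ≤ (P.L : ℝ) ^ 2 * a := by
    have := dist1_rect_le_mul hU hμκ (Site.blockSite y r) P.L P.L; rw [← hR₀] at this; nlinarith
  have hR₁1 : dist1 R₁ ≤ (P.L : ℝ) ^ 2 * a := by
    have := dist1_rect_le_mul hU hμκ (Site.blockSite (y.shift ν) r) P.L P.L; rw [← hR₁] at this; nlinarith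
  have hZ1 : dist1 (h₀ * R₀ * h₀⁻¹) ≤ (P.L : ℝ) ^ 2 * a := by rw [GaugeGroup.dist1_conj]; exact hR₀1
  have hC1 : dist1 C⁻¹ ≤ 6 * t := by rw [GaugeGroup.dist1_inv]; exact dist1_corr_le ha hU hδ ⟨y, ν⟩
  -- step (i): remove the correction factor
  rw [hu]
  have hsplit : (C * A)⁻¹ * (h₀ * R₀ * h₀⁻¹) * (C * A) = A⁻¹ * (C⁻¹ * (h₀ * R₀ * h₀⁻¹) * C⁻¹⁻¹) * A := by group
  rw [hsplit]
  have step1 : ‖((A⁻¹ * (C⁻¹ * (h₀ * R₀ * h₀⁻¹) * C⁻¹⁻¹) * A : Matrix.specialUnitaryGroup n ℂ) : Matrix n n ℂ) -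
      ((A⁻¹ * (h₀ * R₀ * h₀⁻¹) * A : Matrix.specialUnitaryGroup n ℂ) : Matrix n n ℂ)‖ ≤ 12 * t * ((P.L : ℝ) ^ 2 * a) := by
    rw [coe_mul_su (A⁻¹ * _) A, coe_mul_su A⁻¹, coe_mul_su (A⁻¹ * _) A, coe_mul_su A⁻¹ (h₀ * R₀ * h₀⁻¹)]
    refine (norm_inv_conj_sub_le A _ _).trans ((norm_conj_sub_self_le C⁻¹ (h₀ * R₀ * h₀⁻¹)).trans ?_)
    calc 2 * dist1 C⁻¹ * dist1 (h₀ * R₀ * h₀⁻¹) ≤ 2 * (6 * t) * ((P.L : ℝ) ^ 2 * a) :=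
          mul_le_mul (mul_le_mul_of_nonneg_left hC1 zero_le_two) hZ1 (GaugeGroup.dist1_nonneg _) (by positivity)
      _ = 12 * t * ((P.L : ℝ) ^ 2 * a) := by ring
  -- step (ii): the conjugate rule with the staircase ladder, then the `L`-step difference of the square
  have step2 : ‖((A⁻¹ * (h₀ * R₀ * h₀⁻¹) * A : Matrix.specialUnitaryGroup n ℂ) : Matrix n n ℂ) -
      ((h₁ * R₁ * h₁⁻¹ : Matrix.specialUnitaryGroup n ℂ) : Matrix n n ℂ)‖ ≤
      (P.L : ℝ) ^ 3 * b + 4 * (P.L : ℝ) ^ 4 * a ^ 2 + 2 * t * ((P.L : ℝ) ^ 2 * a) := by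
    refine (covDiff_conj_le A N h₀ h₁ R₀ R₁).trans ?_
    have hlad : dist1 (h₁⁻¹ * A⁻¹ * h₀ * N) ≤ t := dist1_staircaseLadder_le hj ha hU y ν r σ
    have hsq : ‖((N⁻¹ * R₀ * N : Matrix.specialUnitaryGroup n ℂ) : Matrix n n ℂ) - (R₁ : Matrix n n ℂ)‖ ≤
        (P.L : ℝ) ^ 3 * b + 4 * (P.L : ℝ) ^ 4 * a ^ 2 := by
      rw [hR₁, blockSite_shift hj]
      refine (covDiff_rect_steps_le ha hU hμκ ν hb P.L P.L (Site.blockSite y r) P.L).trans (le_of_eq ?_)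
      ring
    have h2 : 2 * dist1 (h₁⁻¹ * A⁻¹ * h₀ * N) * dist1 R₁ ≤ 2 * t * ((P.L : ℝ) ^ 2 * a) :=
      mul_le_mul (mul_le_mul_of_nonneg_left hlad zero_le_two) hR₁1 (GaugeGroup.dist1_nonneg _) (by positivity)
    linarith
  calc _ ≤ ‖((A⁻¹ * (C⁻¹ * (h₀ * R₀ * h₀⁻¹) * C⁻¹⁻¹) * A : Matrix.specialUnitaryGroup n ℂ) : Matrix n n ℂ) -
          ((A⁻¹ * (h₀ * R₀ * h₀⁻¹) * A : Matrix.specialUnitaryGroup n ℂ) : Matrix n n ℂ)‖ +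
        ‖((A⁻¹ * (h₀ * R₀ * h₀⁻¹) * A : Matrix.specialUnitaryGroup n ℂ) : Matrix n n ℂ) -
          ((h₁ * R₁ * h₁⁻¹ : Matrix.specialUnitaryGroup n ℂ) : Matrix n n ℂ)‖ := norm_sub_le_norm_sub_add_norm_sub _ _ _
    _ ≤ 12 * t * ((P.L : ℝ) ^ 2 * a) + ((P.L : ℝ) ^ 3 * b + 4 * (P.L : ℝ) ^ 4 * a ^ 2 + 2 * t * ((P.L : ℝ) ^ 2 * a)) :=
        add_le_add step1 step2
    _ = _ := by ring

end PerQ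

/-! ## §3 Means, and the one-step covariant difference of a coarse plaquette -/

section Main

variable {n : Type*} [Fintype n] [DecidableEq n] [Nonempty n] {P : Params} {j : ℕ}

omit [Nonempty n] in
/-- Conjugation commutes with taking the mean. [folklore] -/
theorem coe_inv_mul_mean_mul_coe {ι : Type*} [Fintype ι] (u : Matrix.specialUnitaryGroup n ℂ) (X : ι → Matrix n n ℂ) :
    ((u⁻¹ : Matrix.specialUnitaryGroup n ℂ) : Matrix n n ℂ) * (((Fintype.card ι : ℂ))⁻¹ • ∑ i, X i) * (u : Matrix n n ℂ) =
      ((Fintype.card ι : ℂ))⁻¹ • ∑ i, ((u⁻¹ : Matrix.specialUnitaryGroup n ℂ) : Matrix n n ℂ) * X i * (u : Matrix n n ℂ) := by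
  rw [mul_smul_comm, smul_mul_assoc, Finset.mul_sum, Finset.sum_mul]

omit [Fintype n] [DecidableEq n] [Nonempty n] in
/-- The difference of two means is the mean of the differences. [folklore] -/
theorem mean_sub_mean {ι : Type*} [Fintype ι] (X Y : ι → Matrix n n ℂ) :
    ((Fintype.card ι : ℂ))⁻¹ • ∑ i, X i - ((Fintype.card ι : ℂ))⁻¹ • ∑ i, Y i = ((Fintype.card ι : ℂ))⁻¹ • ∑ i, (X i - Y i) := by
  rw [← smul_sub, Finset.sum_sub_distrib]

/-- **THE ONE-STEP COVARIANT DIFFERENCE OF A COARSE PLAQUETTE OF THE (0.4)-AVERAGED FIELD** (`SU(N)` in `M_N(ℂ)`, any torus, standing range,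
plane `μ < κ`, direction `ν`): if every fine plaquette is within `a ≥ 0` of `1`, `t := (((d+2)L)²/4)·a ≤ 1/10`, `t < δ_N`, and every one-step
covariant difference (direction `ν`) of the fine plaquette field of the plane is `≤ b`, then for every coarse site `y`
`‖Ū(y,ν)⁻¹·Ū(∂p′(y))·Ū(y,ν) − Ū(∂p′(y+e_ν))‖ ≤ 870t² + (L³b + 4L⁴a² + 14t·L²a)` — the sibling identity (coarse plaquette = mean of
staircase-transported squares `+ O(435t²)`, twice), conjugation through the mean, and §2 termwise. [cite: Balaban1985Averaging, Prop. 3 (122)-(123) p.36] -/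
theorem norm_covDiff_plaqHol_avgFun_le (hj : j + 1 ≤ P.m + P.K) {a b : ℝ} (ha : 0 ≤ a)
    {U : GaugeField P j (Matrix.specialUnitaryGroup n ℂ)} (hU : PlaqSmall a U)
    (ht : ((((P.d + 2) * P.L : ℕ) : ℝ) ^ 2 / 4) * a ≤ 1 / 10) (hδ : ((((P.d + 2) * P.L : ℕ) : ℝ) ^ 2 / 4) * a < deltaSU n)
    {μ κ : Fin P.d} (hμκ : μ < κ) (ν : Fin P.d)
    (hb : ∀ z : Site P j, ‖(((U ⟨z, ν⟩)⁻¹ * GaugeField.plaqHol U ⟨z, μ, κ, hμκ⟩ * U ⟨z, ν⟩ : Matrix.specialUnitaryGroup n ℂ) :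
        Matrix n n ℂ) - ((GaugeField.plaqHol U ⟨z.shift ν, μ, κ, hμκ⟩ : Matrix.specialUnitaryGroup n ℂ) : Matrix n n ℂ)‖ ≤ b)
    (y : Site P (j + 1)) :
    ‖(((avgFun (expMeanLogSU (n := n)) U ⟨y, ν⟩)⁻¹ * GaugeField.plaqHol (avgFun (expMeanLogSU (n := n)) U) ⟨y, μ, κ, hμκ⟩ *
            avgFun (expMeanLogSU (n := n)) U ⟨y, ν⟩ : Matrix.specialUnitaryGroup n ℂ) : Matrix n n ℂ) -
        ((GaugeField.plaqHol (avgFun (expMeanLogSU (n := n)) U) ⟨y.shift ν, μ, κ, hμκ⟩ : Matrix.specialUnitaryGroup n ℂ) :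
          Matrix n n ℂ)‖ ≤
      870 * (((((P.d + 2) * P.L : ℕ) : ℝ) ^ 2 / 4) * a) ^ 2 +
        ((P.L : ℝ) ^ 3 * b + 4 * (P.L : ℝ) ^ 4 * a ^ 2 + 14 * (((((P.d + 2) * P.L : ℕ) : ℝ) ^ 2 / 4) * a) * ((P.L : ℝ) ^ 2 * a)) := by
  set t : ℝ := ((((P.d + 2) * P.L : ℕ) : ℝ) ^ 2 / 4) * a with ht_def
  set u := avgFun (expMeanLogSU (n := n)) U ⟨y, ν⟩ with hu
  set F₀ := GaugeField.plaqHol (avgFun (expMeanLogSU (n := n)) U) ⟨y, μ, κ, hμκ⟩ with hF₀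
  set F₁ := GaugeField.plaqHol (avgFun (expMeanLogSU (n := n)) U) ⟨y.shift ν, μ, κ, hμκ⟩ with hF₁
  -- the transported squares at `y` and at `y + e_ν`
  set X : (Fin P.d → Fin P.L) × Equiv.Perm (Fin P.d) → Matrix n n ℂ := fun q =>
    ((holAt U (walk (emb y) (stairWord q.2 (off q.1))) * rect U (Site.blockSite y q.1) μ κ P.L P.L *
        (holAt U (walk (emb y) (stairWord q.2 (off q.1))))⁻¹ : Matrix.specialUnitaryGroup n ℂ) : Matrix n n ℂ) with hX
  set Y : (Fin P.d → Fin P.L) × Equiv.Perm (Fin P.d) → Matrix n n ℂ := fun q =>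
    ((holAt U (walk (emb (y.shift ν)) (stairWord q.2 (off q.1))) * rect U (Site.blockSite (y.shift ν) q.1) μ κ P.L P.L *
        (holAt U (walk (emb (y.shift ν)) (stairWord q.2 (off q.1))))⁻¹ : Matrix.specialUnitaryGroup n ℂ) : Matrix n n ℂ) with hY
  set c : ℂ := ((Fintype.card ((Fin P.d → Fin P.L) × Equiv.Perm (Fin P.d)) : ℂ))⁻¹ with hc
  have e₀ : ‖(F₀ : Matrix n n ℂ) - c • ∑ q, X q‖ ≤ 435 * t ^ 2 :=
    norm_plaqHol_avgFun_sub_mean_conj_rect_le hj ha hU ht hδ ⟨y, μ, κ, hμκ⟩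
  have e₁ : ‖(F₁ : Matrix n n ℂ) - c • ∑ q, Y q‖ ≤ 435 * t ^ 2 :=
    norm_plaqHol_avgFun_sub_mean_conj_rect_le hj ha hU ht hδ ⟨y.shift ν, μ, κ, hμκ⟩
  have hb0 : 0 ≤ b := (norm_nonneg _).trans (hb (emb y))
  -- the three pieces
  have p1 : ‖((u⁻¹ * F₀ * u : Matrix.specialUnitaryGroup n ℂ) : Matrix n n ℂ) -
      ((u⁻¹ : Matrix.specialUnitaryGroup n ℂ) : Matrix n n ℂ) * (c • ∑ q, X q) * (u : Matrix n n ℂ)‖ ≤ 435 * t ^ 2 := by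
    rw [coe_mul_su (u⁻¹ * F₀) u, coe_mul_su u⁻¹ F₀]
    exact (norm_inv_conj_sub_le u _ _).trans e₀
  have p2 : ‖((u⁻¹ : Matrix.specialUnitaryGroup n ℂ) : Matrix n n ℂ) * (c • ∑ q, X q) * (u : Matrix n n ℂ) - c • ∑ q, Y q‖ ≤
      (P.L : ℝ) ^ 3 * b + 4 * (P.L : ℝ) ^ 4 * a ^ 2 + 14 * t * ((P.L : ℝ) ^ 2 * a) := by
    rw [hc, coe_inv_mul_mean_mul_coe, mean_sub_mean]
    refine norm_mean_le (fun q => ?_) (by positivity)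
    rw [hX, hY]
    simp only
    rw [← coe_mul_su, ← coe_mul_su]
    exact norm_covDiff_conj_rect_le hj ha hU hδ hμκ ν hb y q.1 q.2
  have p3 : ‖c • ∑ q, Y q - (F₁ : Matrix n n ℂ)‖ ≤ 435 * t ^ 2 := by rw [norm_sub_rev]; exact e₁
  calc ‖((u⁻¹ * F₀ * u : Matrix.specialUnitaryGroup n ℂ) : Matrix n n ℂ) - (F₁ : Matrix n n ℂ)‖
      ≤ ‖((u⁻¹ * F₀ * u : Matrix.specialUnitaryGroup n ℂ) : Matrix n n ℂ) -
            ((u⁻¹ : Matrix.specialUnitaryGroup n ℂ) : Matrix n n ℂ) * (c • ∑ q, X q) * (u : Matrix n n ℂ)‖ +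
          ‖((u⁻¹ : Matrix.specialUnitaryGroup n ℂ) : Matrix n n ℂ) * (c • ∑ q, X q) * (u : Matrix n n ℂ) - (F₁ : Matrix n n ℂ)‖ :=
        norm_sub_le_norm_sub_add_norm_sub _ _ _
    _ ≤ ‖((u⁻¹ * F₀ * u : Matrix.specialUnitaryGroup n ℂ) : Matrix n n ℂ) -
            ((u⁻¹ : Matrix.specialUnitaryGroup n ℂ) : Matrix n n ℂ) * (c • ∑ q, X q) * (u : Matrix n n ℂ)‖ +
          (‖((u⁻¹ : Matrix.specialUnitaryGroup n ℂ) : Matrix n n ℂ) * (c • ∑ q, X q) * (u : Matrix n n ℂ) - c • ∑ q, Y q‖ +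
            ‖c • ∑ q, Y q - (F₁ : Matrix n n ℂ)‖) := add_le_add le_rfl (norm_sub_le_norm_sub_add_norm_sub _ _ _)
    _ ≤ 435 * t ^ 2 + (((P.L : ℝ) ^ 3 * b + 4 * (P.L : ℝ) ^ 4 * a ^ 2 + 14 * t * ((P.L : ℝ) ^ 2 * a)) + 435 * t ^ 2) :=
        add_le_add p1 (add_le_add p2 p3)
    _ = _ := by ring

end Main

end Summit.QuantumFields.YangMills.Theorems.AvgCurvGrad

end
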